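import Summits.Ventures.Crystal3D.Theorems.StickyWulffConstantPolycrystalWulffBoundPerSelf
import Summits.Ventures.Crystal3D.Theorems.StickyWulffConstantTextureLiminfTexShadowVocabularyV5
import Summits.Ventures.Crystal3D.Theorems.StickyWulffConstantLiminfAssemblyOfV5
import HarnessLib

/-!
# `TextureLiminfV5` follows from `SurfaceLiminf`: the v5 split of `LiminfAssembly` loses nothing (statement hygiene for stmt-Ventures-23912)

Route `StickyWulffConstant` of the venture `Summits/Ventures/Crystal3D` (cell `crystal3d-full`).  Split v5 (route rev 11, cf-p1 g30)
replaced the wall law `(1, ½)` by `(13/25, ½)`: items `GenericWallFloorV5` (23910), `PolycrystalWulffBoundV5` (23911), `TextureLiminfV5`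
(23912) with the PROVED glue `liminfAssembly_of_v5 : G₅ → F → P₅ → T₅ → LiminfAssembly` (p683586).  This file is the v5 twin of
`…TextureLiminfOfSurfaceLiminf` (the v4 sanity certificate): the converse direction, UNCONDITIONALLY, and in fact at EVERY law —
* `texLiminfAt_of_surfaceLiminf : SurfaceLiminf → TexLiminfAt c₀ c₁ GWF CWL` (all `c₀ c₁ GWF CWL`),
* `textureLiminfV5_of_surfaceLiminf : SurfaceLiminf → TextureLiminfV5`,
* `textureLiminfV5_of_liminfAssembly : LiminfAssembly → TextureLiminfV5`,
* `textureLiminfV5_iff_liminfAssembly : G₅ → F → P₅ → (TextureLiminfV5 ↔ LiminfAssembly)`;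
so `TextureLiminfV5` as filed is implied by the summit's target `SurfaceLiminf` (it is not over-stated) and, given the other three v5
siblings, is EXACTLY its share of `LiminfAssembly`.  Proof = the v4 one verbatim: the witness is the single texture «one Wulff grain of
mass one» (`polycrystalWulffBound_wulffGrain`: finite perimeter, `√2·Vol = 1`, energy `6·2^{1/3}`), whose law clauses are VACUOUS (one
grain, no pairs) — hence every law `(c₀, c₁)`; `SurfaceLiminf` with `ε = η` bounds the deficiency below eventually (`φ = id`).
WHAT THIS IS NOT: a proof of `TextureLiminfV5` (open: bulk crystallinity / compactness — TexShadow v8's stubs); F-C1 not moved.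
-/

noncomputable section

namespace Summit.Ventures.Crystal3D.Cruxes.TextureLiminf.TexShadow

open MeasureTheory Set Filter
open scoped RealInnerProductSpace ENNReal Pointwise
open Summit.Ventures.Crystal3D Summit.Ventures.Crystal3D.Theorems

/-- **`SurfaceLiminf ⟹` the profile form of the texture liminf AT EVERY LAW `(c₀, c₁)` and for every pair of wall siblings.**  The
single texture «one Wulff grain of mass one» (`x₀ = 0`, `A = 1`, `r = (32√2)^{-1/3}`) is a `(c₀, c₁)`-texture for every law (no pairs),
has mass `√2·32 r³ = 1 ≥ 1 − δ` and energy exactly `6·2^{1/3}`, while `SurfaceLiminf` makes `deficiency/N^{2/3} ≥ 6·2^{1/3} − η`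
eventually along ANY sequence with `N_k → ∞` (`φ = id`). -/
theorem texLiminfAt_of_surfaceLiminf {c₀ c₁ : ℝ} {GWF CWL : Prop}
    (hSL : Summit.Ventures.Crystal3D.Theses.StickyWulffConstant.SurfaceLiminf) :
    TexLiminfAt c₀ c₁ GWF CWL := by
  intro _ _ _ _ K δ η hδ hη Nseq x hx hN _
  -- the Wulff grain of mass one: `√2·32·r³ = 1`
  obtain ⟨r, hr, hr3⟩ : ∃ r : ℝ, 0 < r ∧ Real.sqrt 2 * (32 * r ^ 3) = 1 := by
    refine ⟨((32 * Real.sqrt 2)⁻¹) ^ ((1 : ℝ) / 3), by positivity, ?_⟩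
    rw [← Real.rpow_mul_natCast (by positivity)]
    norm_num
    have h2 : (0 : ℝ) < Real.sqrt 2 := Real.sqrt_pos.2 (by norm_num)
    field_simp
  obtain ⟨hTex, -, hVol, hEq⟩ := polycrystalWulffBound_wulffGrain
    (LinearIsometryEquiv.refl ℝ (EuclideanSpace ℝ (Fin 3))) 0 r hr (fun _ _ => 0) (fun _ _ => 0)
  have hne : ∀ f g : Fin 1, f ≠ g → False := fun f g h => h (Subsingleton.elim f g)
  -- the same facts, re-typed in the tree's texture vocabulary at law `(c₀, c₁)` (the law clauses are vacuous for one grain)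
  have hTex' : IsTexture c₀ c₁ 1 (fun _ => (0 : E3) +ᵥ (r • wulffOf (LinearIsometryEquiv.refl ℝ E3)))
      (fun _ => LinearIsometryEquiv.refl ℝ E3) (fun _ _ => 0) (fun _ _ => 0) :=
    ⟨hTex.1, fun f g h => (hne f g h).elim, fun f g h => (hne f g h).elim, fun f g h => (hne f g h).elim,
      fun f g h => (hne f g h).elim⟩
  have hVol' : vol 1 (fun _ => (0 : E3) +ᵥ (r • wulffOf (LinearIsometryEquiv.refl ℝ E3))) = 32 * r ^ 3 := hVol
  have hEq' : 6 * (2 : ℝ) ^ ((1 : ℝ) / 3) *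
      (Real.sqrt 2 * vol 1 (fun _ => (0 : E3) +ᵥ (r • wulffOf (LinearIsometryEquiv.refl ℝ E3)))) ^ ((2 : ℝ) / 3) =
      energy 1 (fun _ => (0 : E3) +ᵥ (r • wulffOf (LinearIsometryEquiv.refl ℝ E3)))
        (fun _ => LinearIsometryEquiv.refl ℝ E3) (fun _ _ => 0) (fun _ _ => 0) := hEq
  have hE1 : energy 1 (fun _ => (0 : E3) +ᵥ (r • wulffOf (LinearIsometryEquiv.refl ℝ E3)))
      (fun _ => LinearIsometryEquiv.refl ℝ E3) (fun _ _ => 0) (fun _ _ => 0) = 6 * (2 : ℝ) ^ ((1 : ℝ) / 3) := by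
    rw [← hEq', hVol', hr3, Real.one_rpow, mul_one]
  refine ⟨fun k => k, fun a b hab => hab, 1, fun _ => 1,
    fun _ _ => (0 : E3) +ᵥ (r • wulffOf (LinearIsometryEquiv.refl ℝ E3)),
    fun _ _ => LinearIsometryEquiv.refl ℝ E3, fun _ _ _ => 0, fun _ _ _ => 0, fun _ => hTex', ?_, ?_⟩
  · -- mass `√2 · 32 r³ = 1 ≥ 1 - δ`
    simp only [Finset.univ_unique, Fin.default_eq_zero, Finset.sum_singleton]
    rw [hVol', hr3]
    linarith
  · -- energy `6·2^{1/3}` versus `SurfaceLiminf` with `ε = η`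
    obtain ⟨N₀, hN₀⟩ := hSL η hη
    filter_upwards [hN.eventually_ge_atTop (max N₀ 1)] with k hk
    have hk₀ : N₀ ≤ Nseq k := le_of_max_le_left hk
    have hk₁ : 1 ≤ Nseq k := le_of_max_le_right hk
    have hSLk := hN₀ (Nseq k) hk₀ (x k) (hx k)
    have hNpos : (0 : ℝ) < (Nseq k : ℝ) ^ ((2 : ℝ) / 3) := by
      apply Real.rpow_pos_of_pos; exact_mod_cast hk₁
    simp only [Finset.univ_unique, Fin.default_eq_zero, Finset.sum_singleton]
    rw [hE1, le_div_iff₀ hNpos]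
    exact hSLk

/-- **The v5 split loses nothing: `SurfaceLiminf → TextureLiminfV5`** (stmt-Ventures-23912 is implied by the target `SurfaceLiminf`). -/
theorem textureLiminfV5_of_surfaceLiminf
    (hSL : Summit.Ventures.Crystal3D.Theses.StickyWulffConstant.SurfaceLiminf) :
    Summit.Ventures.Crystal3D.Theses.StickyWulffConstant.TextureLiminfV5 :=
  textureLiminfV5_iff.2 (texLiminfAt_of_surfaceLiminf hSL)

/-- **Corollary: `LiminfAssembly → TextureLiminfV5`** (`TextureLiminfV5` carries `NoReconstructionGain` and `StackingLiminf` among its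
hypotheses, which feed `LiminfAssembly = NRG → SL → SurfaceLiminf`). -/
theorem textureLiminfV5_of_liminfAssembly
    (hLA : Summit.Ventures.Crystal3D.Theses.StickyWulffConstant.LiminfAssembly) :
    Summit.Ventures.Crystal3D.Theses.StickyWulffConstant.TextureLiminfV5 :=
  textureLiminfV5_iff.2 fun hG hF hNRG hStack =>
    texLiminfAt_of_surfaceLiminf (hLA hNRG hStack) hG hF hNRG hStack

/-- **Given G₅, F and P₅, `TextureLiminfV5 ⟺ LiminfAssembly`** — the v5 split is exact: the proved glue `liminfAssembly_of_v5`
(p683586) one way, `textureLiminfV5_of_liminfAssembly` the other. -/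
theorem textureLiminfV5_iff_liminfAssembly
    (hG : Summit.Ventures.Crystal3D.Theses.StickyWulffConstant.GenericWallFloorV5)
    (hF : Summit.Ventures.Crystal3D.Theses.StickyWulffConstant.CoaxialWallLaw)
    (hP : Summit.Ventures.Crystal3D.Theses.StickyWulffConstant.PolycrystalWulffBoundV5) :
    Summit.Ventures.Crystal3D.Theses.StickyWulffConstant.TextureLiminfV5 ↔
      Summit.Ventures.Crystal3D.Theses.StickyWulffConstant.LiminfAssembly :=
  ⟨liminfAssembly_of_v5 hG hF hP, textureLiminfV5_of_liminfAssembly⟩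

end Summit.Ventures.Crystal3D.Cruxes.TextureLiminf.TexShadow

end
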